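import Mathlib
import HarnessLib
import Summits.NavierStokesRegularity.NavierStokesRegularity.Theorems.PoloidalWindowDoorLrcModEntireAxisKinematics

/-!
# Route `PoloidalWindowDoor`, item `LrcModEntire` (stmt-NavierStokesRegularity-20428) — AXIS KINEMATICS III: the commutator of the vertical
# derivative with the rotation generator about a MOVING centre, `[∂₂, L_{c(z)}] = −∂_{Jc′(z)}`

Cell ns-regularity-ideate, seat ns-poloidal-K2-p3 gen 5 (LEAD of item 20428; file landed `--supports stmt-NavierStokesRegularity-20428` as a
helper).  Third kernel brick of AXIS-NOTE (step 4, Lie-derivative route).  For a centre curve `z ↦ (c₀(z), c₁(z))` of class `C²` and the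
generator `L V(y) := (y₀ − c₀(y₂)) ∂₁V(y) − (y₁ − c₁(y₂)) ∂₀V(y)` (`= DV(y)[J(y − c(y₂))]`) of the rotations about the vertical line through
the height-dependent centre:

* `fderiv_vert_coordMul`, `fderiv2_vert_coordMul` — `∂₂` and `∂₂²` of `y ↦ (y_i − γ(y₂)) A(y)` (`i` horizontal):
  `−γ′A + (y_i − γ)∂₂A` and `−γ″A − 2γ′∂₂A + (y_i − γ)∂₂²A`;
* `vert2_rotDeriv_moving` — **`∂₂²(L V) = L(∂₂²V) − 2(c₀′ ∂₁∂₂V − c₁′ ∂₀∂₂V) − (c₀″ ∂₁V − c₁″ ∂₀V)`** for `V ∈ C³` (third-order symmetry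
  `∂₂²∂_bV = ∂_b∂₂²V`);
* `rotGerm_vert2_moving` — **if `L V = 0` on an open `U` then `L(∂₂²V) = 2(c₀′ ∂₁∂₂V − c₁′ ∂₀∂₂V) + (c₀″ ∂₁V − c₁″ ∂₀V)` on `U`**, i.e.
  `K·∇(∂_z²V) = 2∂_{Jc′}∂_z V + ∂_{Jc″}V` — the identity (★) of AXIS-NOTE whose angular structure forces `c′ = 0` or a quadratic profile.

WHAT THIS IS NOT: not a claim about Navier–Stokes regularity and not the axis lemma — calculus (bears_on LADDER-NS N0 via item 20428).
-/

noncomputable section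

-- the summit and its single sub-problem share the name (CONVENTIONS §1), as in every Theorems file
set_option linter.dupNamespace false

namespace Summit.NavierStokesRegularity.NavierStokesRegularity.Theorems.PoloidalWindowDoorLrcModEntireAxisKinematics3

open Set Function Filter Topology Metric
open scoped RealInnerProductSpace InnerProductSpace
open Literature.Analysis Literature.Analysis.FluidPDE
open Summit.NavierStokesRegularity.NavierStokesRegularity.Theorems.PoloidalWindowDoorPoloidalWindowRigidityConstantShearMeans
open Summit.NavierStokesRegularity.NavierStokesRegularity.Theorems.PoloidalWindowDoorLrcModEntireAxisKinematics

/-! ### Vertical derivatives of `y ↦ (y_i − γ(y₂)) A(y)` -/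

/-- The coefficient `y ↦ y_i − γ(y₂)` and its derivative `w ↦ w_i − γ′(y₂) w₂`. -/
theorem hasFDerivAt_coordSubFun {γ : ℝ → ℝ} {y : EuclideanSpace ℝ (Fin 3)} (hγ : DifferentiableAt ℝ γ (y 2)) (i : Fin 3) :
    HasFDerivAt (fun y' : EuclideanSpace ℝ (Fin 3) => y' i - γ (y' 2))
      ((EuclideanSpace.proj i : EuclideanSpace ℝ (Fin 3) →L[ℝ] ℝ) -
        deriv γ (y 2) • (EuclideanSpace.proj (2 : Fin 3) : EuclideanSpace ℝ (Fin 3) →L[ℝ] ℝ)) y := by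
  have h2 : HasFDerivAt (fun y' : EuclideanSpace ℝ (Fin 3) => y' 2)
      (EuclideanSpace.proj (2 : Fin 3) : EuclideanSpace ℝ (Fin 3) →L[ℝ] ℝ) y :=
    (EuclideanSpace.proj (2 : Fin 3) : EuclideanSpace ℝ (Fin 3) →L[ℝ] ℝ).hasFDerivAt
  have hc : HasFDerivAt (fun y' : EuclideanSpace ℝ (Fin 3) => γ (y' 2))
      (deriv γ (y 2) • (EuclideanSpace.proj (2 : Fin 3) : EuclideanSpace ℝ (Fin 3) →L[ℝ] ℝ)) y := by
    exact hγ.hasDerivAt.comp_hasFDerivAt y h2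
  exact (EuclideanSpace.proj i : EuclideanSpace ℝ (Fin 3) →L[ℝ] ℝ).hasFDerivAt.sub hc

/-- **`∂₂[(y_i − γ(y₂)) A] = −γ′(y₂) A + (y_i − γ(y₂)) ∂₂A`** for a horizontal index `i ≠ 2`. -/
theorem fderiv_vert_coordMul {γ : ℝ → ℝ} {A : EuclideanSpace ℝ (Fin 3) → ℝ} {y : EuclideanSpace ℝ (Fin 3)}
    (hγ : DifferentiableAt ℝ γ (y 2)) (hA : DifferentiableAt ℝ A y) {i : Fin 3} (hi : i ≠ 2) :
    fderiv ℝ (fun y' : EuclideanSpace ℝ (Fin 3) => (y' i - γ (y' 2)) * A y') y (EuclideanSpace.single 2 1) =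
      -deriv γ (y 2) * A y + (y i - γ (y 2)) * fderiv ℝ A y (EuclideanSpace.single 2 1) := by
  have hD : HasFDerivAt (fun y' : EuclideanSpace ℝ (Fin 3) => (y' i - γ (y' 2)) * A y')
      ((y i - γ (y 2)) • fderiv ℝ A y + A y • ((EuclideanSpace.proj i : EuclideanSpace ℝ (Fin 3) →L[ℝ] ℝ) -
        deriv γ (y 2) • (EuclideanSpace.proj (2 : Fin 3) : EuclideanSpace ℝ (Fin 3) →L[ℝ] ℝ))) y :=
    (hasFDerivAt_coordSubFun hγ i).mul hA.hasFDerivAt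
  rw [hD.fderiv]
  have hpi : (EuclideanSpace.proj i : EuclideanSpace ℝ (Fin 3) →L[ℝ] ℝ) (EuclideanSpace.single 2 (1 : ℝ)) = 0 := by
    show (EuclideanSpace.single 2 (1 : ℝ) : EuclideanSpace ℝ (Fin 3)) i = 0
    simp [hi]
  have hp2 : (EuclideanSpace.proj (2 : Fin 3) : EuclideanSpace ℝ (Fin 3) →L[ℝ] ℝ) (EuclideanSpace.single 2 (1 : ℝ)) = 1 := by
    show (EuclideanSpace.single 2 (1 : ℝ) : EuclideanSpace ℝ (Fin 3)) 2 = 1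
    simp
  simp only [add_apply, smul_apply, sub_apply, smul_eq_mul, hpi, hp2]
  ring

/-- **`∂₂²[(y_i − γ(y₂)) A] = −γ″A − 2γ′ ∂₂A + (y_i − γ) ∂₂²A`** (`γ, A ∈ C²`, `i ≠ 2`). -/
theorem fderiv2_vert_coordMul {γ : ℝ → ℝ} {A : EuclideanSpace ℝ (Fin 3) → ℝ} (hγ : ContDiff ℝ 2 γ) (hA : ContDiff ℝ 2 A)
    (y : EuclideanSpace ℝ (Fin 3)) {i : Fin 3} (hi : i ≠ 2) :
    fderiv ℝ (fun y' => fderiv ℝ (fun y'' : EuclideanSpace ℝ (Fin 3) => (y'' i - γ (y'' 2)) * A y'') y' (EuclideanSpace.single 2 1)) y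
        (EuclideanSpace.single 2 1) =
      -deriv (deriv γ) (y 2) * A y - 2 * deriv γ (y 2) * fderiv ℝ A y (EuclideanSpace.single 2 1) +
        (y i - γ (y 2)) * fderiv ℝ (fun y' => fderiv ℝ A y' (EuclideanSpace.single 2 1)) y (EuclideanSpace.single 2 1) := by
  have hγd : Differentiable ℝ γ := hγ.differentiable (by norm_num)
  have hγ'd : Differentiable ℝ (deriv γ) := by
    have := hγ.iterate_deriv' 1 1
    simpa using this.differentiable (by norm_num)
  have hAd : Differentiable ℝ A := hA.differentiable (by norm_num)
  have hA2d : Differentiable ℝ (fun y' => fderiv ℝ A y' (EuclideanSpace.single 2 1)) :=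
    ((hA.fderiv_right (m := 1) (by norm_num)).clm_apply contDiff_const).differentiable one_ne_zero
  -- first derivative as a function
  have hfun : (fun y' => fderiv ℝ (fun y'' : EuclideanSpace ℝ (Fin 3) => (y'' i - γ (y'' 2)) * A y'') y' (EuclideanSpace.single 2 1)) =
      fun y' => -deriv γ (y' 2) * A y' + (y' i - γ (y' 2)) * fderiv ℝ A y' (EuclideanSpace.single 2 1) := by
    funext y'
    exact fderiv_vert_coordMul (hγd _) (hAd y') hi
  -- derivative of `y ↦ −γ′(y₂) A(y)` along `e₂`
  have h2 : HasFDerivAt (fun y' : EuclideanSpace ℝ (Fin 3) => y' 2)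
      (EuclideanSpace.proj (2 : Fin 3) : EuclideanSpace ℝ (Fin 3) →L[ℝ] ℝ) y :=
    (EuclideanSpace.proj (2 : Fin 3) : EuclideanSpace ℝ (Fin 3) →L[ℝ] ℝ).hasFDerivAt
  have hc' : HasFDerivAt (fun y' : EuclideanSpace ℝ (Fin 3) => -deriv γ (y' 2))
      (-(deriv (deriv γ) (y 2) • (EuclideanSpace.proj (2 : Fin 3) : EuclideanSpace ℝ (Fin 3) →L[ℝ] ℝ))) y := by
    exact ((hγ'd _).hasDerivAt.comp_hasFDerivAt y h2).neg
  have hD : HasFDerivAt (fun y' : EuclideanSpace ℝ (Fin 3) =>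
        -deriv γ (y' 2) * A y' + (y' i - γ (y' 2)) * fderiv ℝ A y' (EuclideanSpace.single 2 1))
      ((-deriv γ (y 2)) • fderiv ℝ A y + A y • (-(deriv (deriv γ) (y 2) •
          (EuclideanSpace.proj (2 : Fin 3) : EuclideanSpace ℝ (Fin 3) →L[ℝ] ℝ))) +
        ((y i - γ (y 2)) • fderiv ℝ (fun y' => fderiv ℝ A y' (EuclideanSpace.single 2 1)) y +
          fderiv ℝ A y (EuclideanSpace.single 2 1) •
            ((EuclideanSpace.proj i : EuclideanSpace ℝ (Fin 3) →L[ℝ] ℝ) -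
              deriv γ (y 2) • (EuclideanSpace.proj (2 : Fin 3) : EuclideanSpace ℝ (Fin 3) →L[ℝ] ℝ)))) y :=
    (hc'.mul (hAd y).hasFDerivAt).add ((hasFDerivAt_coordSubFun (hγd _) i).mul (hA2d y).hasFDerivAt)
  rw [hfun, hD.fderiv]
  have hpi : (EuclideanSpace.proj i : EuclideanSpace ℝ (Fin 3) →L[ℝ] ℝ) (EuclideanSpace.single 2 (1 : ℝ)) = 0 := by
    show (EuclideanSpace.single 2 (1 : ℝ) : EuclideanSpace ℝ (Fin 3)) i = 0
    simp [hi]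
  have hp2 : (EuclideanSpace.proj (2 : Fin 3) : EuclideanSpace ℝ (Fin 3) →L[ℝ] ℝ) (EuclideanSpace.single 2 (1 : ℝ)) = 1 := by
    show (EuclideanSpace.single 2 (1 : ℝ) : EuclideanSpace ℝ (Fin 3)) 2 = 1
    simp
  simp only [add_apply, smul_apply, sub_apply, neg_apply, smul_eq_mul, hpi, hp2]
  ring

/-! ### `[∂₂², L]` for a moving centre -/

/-- **`∂₂²(L V) = L(∂₂²V) − 2(c₀′ ∂₁∂₂V − c₁′ ∂₀∂₂V) − (c₀″ ∂₁V − c₁″ ∂₀V)`** for `V ∈ C³(ℝ³)` and a `C²` centre curve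
`(c₀, c₁)`, where `L V(y) = (y₀ − c₀(y₂)) ∂₁V(y) − (y₁ − c₁(y₂)) ∂₀V(y)`, all functions of the height evaluated at `y₂`, and
`∂_b∂₂V := D(y ↦ DV(y)e₂)(y) e_b`. -/
theorem vert2_rotDeriv_moving {V : EuclideanSpace ℝ (Fin 3) → ℝ} (hV : ContDiff ℝ 3 V) {c₀ c₁ : ℝ → ℝ}
    (hc₀ : ContDiff ℝ 2 c₀) (hc₁ : ContDiff ℝ 2 c₁) (y : EuclideanSpace ℝ (Fin 3)) :
    fderiv ℝ (fun y' => fderiv ℝ (fun y'' : EuclideanSpace ℝ (Fin 3) =>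
        (y'' 0 - c₀ (y'' 2)) * fderiv ℝ V y'' (EuclideanSpace.single 1 1) -
          (y'' 1 - c₁ (y'' 2)) * fderiv ℝ V y'' (EuclideanSpace.single 0 1)) y' (EuclideanSpace.single 2 1)) y
        (EuclideanSpace.single 2 1) =
      ((y 0 - c₀ (y 2)) *
            fderiv ℝ (fun y' => fderiv ℝ (fun y'' => fderiv ℝ V y'' (EuclideanSpace.single 2 1)) y' (EuclideanSpace.single 2 1)) y
              (EuclideanSpace.single 1 1) -
          (y 1 - c₁ (y 2)) *
            fderiv ℝ (fun y' => fderiv ℝ (fun y'' => fderiv ℝ V y'' (EuclideanSpace.single 2 1)) y' (EuclideanSpace.single 2 1)) y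
              (EuclideanSpace.single 0 1)) -
        2 * (deriv c₀ (y 2) * fderiv ℝ (fun y' => fderiv ℝ V y' (EuclideanSpace.single 2 1)) y (EuclideanSpace.single 1 1) -
              deriv c₁ (y 2) * fderiv ℝ (fun y' => fderiv ℝ V y' (EuclideanSpace.single 2 1)) y (EuclideanSpace.single 0 1)) -
        (deriv (deriv c₀) (y 2) * fderiv ℝ V y (EuclideanSpace.single 1 1) -
          deriv (deriv c₁) (y 2) * fderiv ℝ V y (EuclideanSpace.single 0 1)) := by
  have h1 : ∀ a : EuclideanSpace ℝ (Fin 3), ContDiff ℝ 2 (fun y' => fderiv ℝ V y' a) := fun a =>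
    (hV.fderiv_right (m := 2) (by norm_num)).clm_apply contDiff_const
  have hd2 : ∀ a b : EuclideanSpace ℝ (Fin 3), Differentiable ℝ (fun y' => fderiv ℝ (fun y'' => fderiv ℝ V y'' a) y' b) :=
    fun a b => (((h1 a).fderiv_right (m := 1) (by norm_num)).clm_apply contDiff_const).differentiable one_ne_zero
  have hc₀d : Differentiable ℝ c₀ := hc₀.differentiable (by norm_num)
  have hc₁d : Differentiable ℝ c₁ := hc₁.differentiable (by norm_num)
  -- the two products and their second vertical derivatives
  have hA := fderiv2_vert_coordMul hc₀ (h1 (EuclideanSpace.single 1 1)) y (i := 0) (by decide)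
  have hB := fderiv2_vert_coordMul hc₁ (h1 (EuclideanSpace.single 0 1)) y (i := 1) (by decide)
  -- differentiability of the first vertical derivatives of the products
  have hdprod : ∀ {γ : ℝ → ℝ} (hγ : ContDiff ℝ 2 γ) (i : Fin 3) (hi : i ≠ 2) (a : EuclideanSpace ℝ (Fin 3)),
      Differentiable ℝ (fun y' => fderiv ℝ (fun y'' : EuclideanSpace ℝ (Fin 3) => (y'' i - γ (y'' 2)) * fderiv ℝ V y'' a) y'
        (EuclideanSpace.single 2 1)) := by
    intro γ hγ i hi a
    have hγd : Differentiable ℝ γ := hγ.differentiable (by norm_num)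
    have hγ'd : Differentiable ℝ (deriv γ) := by
      have := hγ.iterate_deriv' 1 1
      simpa using this.differentiable (by norm_num)
    have hfun : (fun y' => fderiv ℝ (fun y'' : EuclideanSpace ℝ (Fin 3) => (y'' i - γ (y'' 2)) * fderiv ℝ V y'' a) y'
        (EuclideanSpace.single 2 1)) = fun y' => -deriv γ (y' 2) * fderiv ℝ V y' a +
          (y' i - γ (y' 2)) * fderiv ℝ (fun y'' => fderiv ℝ V y'' a) y' (EuclideanSpace.single 2 1) := by
      funext y'
      exact fderiv_vert_coordMul (hγd _) (((h1 a).differentiable (by norm_num)) y') hi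
    rw [hfun]
    intro y'
    have hp2 : DifferentiableAt ℝ (fun y'' : EuclideanSpace ℝ (Fin 3) => y'' 2) y' :=
      (EuclideanSpace.proj (2 : Fin 3) : EuclideanSpace ℝ (Fin 3) →L[ℝ] ℝ).differentiableAt
    exact ((((hγ'd _).comp y' hp2).neg).mul (((h1 a).differentiable (by norm_num)) y')).add
      ((hasFDerivAt_coordSubFun (hγd _) i).differentiableAt.mul (hd2 _ _ y'))
  -- split `∂₂(L V) = ∂₂A − ∂₂B` as functions, then `∂₂²`
  have hfun : (fun y' => fderiv ℝ (fun y'' : EuclideanSpace ℝ (Fin 3) =>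
        (y'' 0 - c₀ (y'' 2)) * fderiv ℝ V y'' (EuclideanSpace.single 1 1) -
          (y'' 1 - c₁ (y'' 2)) * fderiv ℝ V y'' (EuclideanSpace.single 0 1)) y' (EuclideanSpace.single 2 1)) =
      fun y' => fderiv ℝ (fun y'' : EuclideanSpace ℝ (Fin 3) => (y'' 0 - c₀ (y'' 2)) * fderiv ℝ V y'' (EuclideanSpace.single 1 1)) y'
          (EuclideanSpace.single 2 1) -
        fderiv ℝ (fun y'' : EuclideanSpace ℝ (Fin 3) => (y'' 1 - c₁ (y'' 2)) * fderiv ℝ V y'' (EuclideanSpace.single 0 1)) y'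
          (EuclideanSpace.single 2 1) := by
    funext y'
    have hDA : DifferentiableAt ℝ (fun y'' : EuclideanSpace ℝ (Fin 3) => (y'' 0 - c₀ (y'' 2)) * fderiv ℝ V y'' (EuclideanSpace.single 1 1)) y' :=
      (hasFDerivAt_coordSubFun (hc₀d _) 0).differentiableAt.mul (((h1 _).differentiable (by norm_num)) y')
    have hDB : DifferentiableAt ℝ (fun y'' : EuclideanSpace ℝ (Fin 3) => (y'' 1 - c₁ (y'' 2)) * fderiv ℝ V y'' (EuclideanSpace.single 0 1)) y' :=
      (hasFDerivAt_coordSubFun (hc₁d _) 1).differentiableAt.mul (((h1 _).differentiable (by norm_num)) y')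
    rw [fderiv_fun_sub hDA hDB, sub_apply]
  rw [hfun, fderiv_fun_sub (hdprod hc₀ 0 (by decide) _ y) (hdprod hc₁ 1 (by decide) _ y), sub_apply, hA, hB]
  -- third-order symmetries: `∂₂²(∂_b V) = ∂_b(∂₂² V)` and `∂₂(∂_b V) = ∂_b(∂₂ V)`
  have hC2 : ContDiff ℝ 2 V := hV.of_le (by norm_num)
  have hinner : ∀ a b : EuclideanSpace ℝ (Fin 3), (fun y' => fderiv ℝ (fun y'' => fderiv ℝ V y'' a) y' b) =
      fun y' => fderiv ℝ (fun y'' => fderiv ℝ V y'' b) y' a := by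
    intro a b; funext y'; exact fderiv_fderiv_symm hC2 y' _ _
  have s3 : ∀ b : EuclideanSpace ℝ (Fin 3),
      fderiv ℝ (fun y' => fderiv ℝ (fun y'' => fderiv ℝ V y'' b) y' (EuclideanSpace.single 2 1)) y (EuclideanSpace.single 2 1) =
        fderiv ℝ (fun y' => fderiv ℝ (fun y'' => fderiv ℝ V y'' (EuclideanSpace.single 2 1)) y' (EuclideanSpace.single 2 1)) y b := by
    intro b
    rw [hinner b (EuclideanSpace.single 2 1), fderiv_fderiv_symm (h1 (EuclideanSpace.single 2 1)) y _ _]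
  have s2 : ∀ b : EuclideanSpace ℝ (Fin 3),
      fderiv ℝ (fun y' => fderiv ℝ V y' b) y (EuclideanSpace.single 2 1) =
        fderiv ℝ (fun y' => fderiv ℝ V y' (EuclideanSpace.single 2 1)) y b := fun b => fderiv_fderiv_symm hC2 y _ _
  rw [s3 (EuclideanSpace.single 1 1), s3 (EuclideanSpace.single 0 1), s2 (EuclideanSpace.single 1 1),
    s2 (EuclideanSpace.single 0 1)]
  ring

/-- **The identity (★) of AXIS-NOTE.**  If `V ∈ C³(ℝ³)` is annihilated on an open set `U` by the rotation generator about the moving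
vertical line through `(c₀(y₂), c₁(y₂))` — `(y₀ − c₀(y₂)) ∂₁V(y) − (y₁ − c₁(y₂)) ∂₀V(y) = 0` for `y ∈ U` — then on `U`
`L(∂₂²V) = 2(c₀′ ∂₁∂₂V − c₁′ ∂₀∂₂V) + (c₀″ ∂₁V − c₁″ ∂₀V)`, i.e. `K·∇(∂_z²V) = 2∂_{Jc′}∂_zV + ∂_{Jc″}V`. -/
theorem rotGerm_vert2_moving {V : EuclideanSpace ℝ (Fin 3) → ℝ} (hV : ContDiff ℝ 3 V) {c₀ c₁ : ℝ → ℝ}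
    (hc₀ : ContDiff ℝ 2 c₀) (hc₁ : ContDiff ℝ 2 c₁) {U : Set (EuclideanSpace ℝ (Fin 3))} (hU : IsOpen U)
    (h : ∀ y ∈ U, (y 0 - c₀ (y 2)) * fderiv ℝ V y (EuclideanSpace.single 1 1) -
      (y 1 - c₁ (y 2)) * fderiv ℝ V y (EuclideanSpace.single 0 1) = 0)
    {y : EuclideanSpace ℝ (Fin 3)} (hy : y ∈ U) :
    (y 0 - c₀ (y 2)) *
          fderiv ℝ (fun y' => fderiv ℝ (fun y'' => fderiv ℝ V y'' (EuclideanSpace.single 2 1)) y' (EuclideanSpace.single 2 1)) y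
            (EuclideanSpace.single 1 1) -
        (y 1 - c₁ (y 2)) *
          fderiv ℝ (fun y' => fderiv ℝ (fun y'' => fderiv ℝ V y'' (EuclideanSpace.single 2 1)) y' (EuclideanSpace.single 2 1)) y
            (EuclideanSpace.single 0 1) =
      2 * (deriv c₀ (y 2) * fderiv ℝ (fun y' => fderiv ℝ V y' (EuclideanSpace.single 2 1)) y (EuclideanSpace.single 1 1) -
            deriv c₁ (y 2) * fderiv ℝ (fun y' => fderiv ℝ V y' (EuclideanSpace.single 2 1)) y (EuclideanSpace.single 0 1)) +
        (deriv (deriv c₀) (y 2) * fderiv ℝ V y (EuclideanSpace.single 1 1) -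
          deriv (deriv c₁) (y 2) * fderiv ℝ V y (EuclideanSpace.single 0 1)) := by
  set g : EuclideanSpace ℝ (Fin 3) → ℝ := fun y'' => (y'' 0 - c₀ (y'' 2)) * fderiv ℝ V y'' (EuclideanSpace.single 1 1) -
    (y'' 1 - c₁ (y'' 2)) * fderiv ℝ V y'' (EuclideanSpace.single 0 1) with hg
  have hg0 : ∀ y' ∈ U, fderiv ℝ g y' = 0 := by
    intro y' hy'
    have hev : g =ᶠ[𝓝 y'] fun _ => (0 : ℝ) := Filter.eventually_of_mem (hU.mem_nhds hy') fun z hz => h z hz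
    rw [hev.fderiv_eq, fderiv_fun_const]; rfl
  have hg2 : fderiv ℝ (fun y' => fderiv ℝ g y' (EuclideanSpace.single 2 1)) y (EuclideanSpace.single 2 1) = 0 := by
    have hev : (fun y' => fderiv ℝ g y' (EuclideanSpace.single 2 1)) =ᶠ[𝓝 y] fun _ => (0 : ℝ) :=
      Filter.eventually_of_mem (hU.mem_nhds hy) fun z hz => by simp only [hg0 z hz, zero_apply]
    rw [hev.fderiv_eq, fderiv_fun_const]; rfl
  rw [hg, vert2_rotDeriv_moving hV hc₀ hc₁ y] at hg2
  linarith

end Summit.NavierStokesRegularity.NavierStokesRegularity.Theorems.PoloidalWindowDoorLrcModEntireAxisKinematics3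

end
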